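import Summits.BirchSwinnertonDyer.Rank1Residual.WAll.TargetAdditiveAtThreeWildLocalTypeSlices
import Literature.NumberTheory.EllipticCurves.GoodReductionPeuRamifieProofs
import HarnessLib
import HarnessLib.Audit.Tags

/-!
# Rung W-ALL, row 2 at `p = 3`, the wild rank-one TWIN cell read through Serre's local type:
# a TRÈS RAMIFIÉ class has only MULTIPLICATIVE semistable twins (theorems only; no new statement)

Cell `bsd-wall` (run/shared/lean/pub/bsd-wall/), lane (2), seat `bsd-wall-ty-1` (g9). BOOKKEEPING in
the vocabulary of `TargetAdditiveAtThreeWildLocalTypeSlices.lean` §0 (`O6.ModPCongruentAt`,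
`O6.HasSemistableModPTypeAt`) and of the twin-cell leaf `WAllExclAddWildRankOneSurjTwin`
(`TargetAdditiveAtThreeWildTwinSlices.lean`): nothing asserted, no leaf typed, no named fact; every
theorem is a consequence of the Literature theorem
`Literature.NumberTheory.EllipticCurves.not_good_of_isTresRamifie_of_addEquiv_decomp`
(`GoodReductionPeuRamifieProofs.lean`, Serre 1987 §2.9 Prop. 5 (i) + §2.8 Prop. 3: at an odd prime of
good reduction `ρ̄_{E,p}|Γ_{ℚ_p}` is peu ramifié, and peu / très ramifié at `v` is an invariant of the
`D_v`-module `E[p]`).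

WHAT IT RECORDS (census memo TWIN-PRINT-AT3-v1 deba1936ea4be18e §2, rigour note «très ramifié ⇒ NO
twin with good reduction at `3` can exist (finite flatness; Serre 1987 §2.8)», bucket B = 675 of the
2 023 twin-having onto wild rank-one classes of record): for a curve `E/ℚ` whose mod-`p` representation
is TRÈS RAMIFIÉ at the place `v` above an odd `p` (for one, equivalently every, framing `ρ̄` of `E[p]`
— `isTresRamifie_restrictField_iff_of_isTorsionGaloisRep`):
* `O6.ModPCongruentAt.not_good_of_isTresRamifie` — no curve congruent to `E` AT `v` has good
  reduction at `p`; `…mult_of_isTresRamifie_of_not_addv` — a congruent curve semistable at `p` is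
  MULTIPLICATIVE at `p`; `O6.ModPCongruent.not_good_of_isTresRamifie` — the same for global twins.
* `O6.HasSemistableModPTypeAt.exists_mult_witness_of_isTresRamifie` — for a très ramifié class the
  «semistable mod-`p` type» of §0 is a MULTIPLICATIVE type: every witness is multiplicative at `p`, so a
  multiplicative witness exists at each `v ∋ p`.
* at `p = 3`, on the twin-cell hypothesis of `WAllExclAddWildRankOneSurjTwin` VERBATIM:
  `twin_mult_three_of_isTresRamifie` — every semistable onto twin of a très ramifié class is
  multiplicative at `3` (`Mult W′ 3`, i.e. `3 ∥ N′`), and `exists_multTwin_three_of_twin_of_isTresRamifie`.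
  Consequence for route `UniversalToricDescent` (crux #3 `TwinSplitIMCAtThree` quantifies over semistable
  twins): on bucket B the crux is consumed ONLY in its `3 ∥ N′` instance — the instance with no printed
  input at `p = 3` (TWIN-PRINT-AT3-v1 §1 row 2; `Literature.Barriers.BirchSwinnertonDyer.NoAdmissiblePrimesAtThree`
  for the bipartite side) — now as a kernel fact at every conductor, not a range statement.

Not here (W-10 «NOT NOW», director-bsd 2026-08-27T11:22:05Z): the A / B / C re-slicing of the twin
cell into named leaves; the predicates it would use are the tree's `ModPGaloisRep.IsPeuRamifie` /
`IsTresRamifie` (`Literature/NumberTheory/GaloisRepresentations/SerreWeight.lean`).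

References: `WAll/TargetAdditiveAtThreeWildLocalTypeSlices.lean` (§0 vocabulary, §1 type leaves),
`WAll/TargetAdditiveAtThreeWildTwinSlices.lean` (twin cell), HOME `TWIN-PRINT-AT3-v1.md`,
`bsd-wall-utd-p2/SUPSET-AT3-v1.md` (partition currency A / B / C); [cite: Serre1987, §2.4 (2.4.7),
§2.8 Prop. 3, §2.9 Prop. 5]; [cite: SerreInventiones1972, §1.11–1.12].
-/

noncomputable section

open scoped Classical NumberField

open IsDedekindDomain Rat.HeightOneSpectrum
open WeierstrassCurve Literature.NumberTheory.EllipticCurves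
  Literature.NumberTheory.EllipticCurves.Rank1Residual
  Literature.NumberTheory.GaloisRepresentations
open Summit.BirchSwinnertonDyer.Rank1Residual

set_option autoImplicit false

/-! ### §1. Vocabulary level (`O6.ModPCongruentAt`, `O6.HasSemistableModPTypeAt`), any odd `p` -/

namespace Summit.BirchSwinnertonDyer.Rank1Residual.O6

variable {W W' : WeierstrassCurve ℚ} {p : ℕ} [Fact p.Prime] {v : HeightOneSpectrum (𝓞 ℚ)}

/-- **Très ramifié at `v` does not depend on the framing** of `E[p]` (two framings are related by
the identity of `E[p]`, which is `D_v`-equivariant). [folklore] -/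
theorem isTresRamifie_restrictField_iff_of_isTorsionGaloisRep {ρ ρ' : ModPGaloisRep ℚ (ZMod p) 2}
    (hρ : W.IsTorsionGaloisRep p ρ) (hρ' : W.IsTorsionGaloisRep p ρ') (v : HeightOneSpectrum (𝓞 ℚ)) :
    ModPGaloisRep.IsTresRamifie (FramedGaloisRep.restrictField (v.adicCompletion ℚ) ρ' :
        ModPGaloisRep (v.adicCompletion ℚ) (ZMod p) 2) ↔
      ModPGaloisRep.IsTresRamifie (FramedGaloisRep.restrictField (v.adicCompletion ℚ) ρ :
        ModPGaloisRep (v.adicCompletion ℚ) (ZMod p) 2) :=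
  isTresRamifie_restrictField_iff_of_addEquiv_decomp hρ hρ' v (AddEquiv.refl _) fun _ _ _ ↦ rfl

/-- **Très ramifié is an invariant of congruence AT `v`**: if `W′[p] ≅ W[p]` as `D_v`-modules then a
framing of `W′[p]` is très ramifié at `v` iff a framing of `W[p]` is. [folklore] -/
theorem ModPCongruentAt.isTresRamifie_restrictField_iff (hc : ModPCongruentAt W' W p v)
    {ρ ρ' : ModPGaloisRep ℚ (ZMod p) 2} (hρ : W.IsTorsionGaloisRep p ρ)
    (hρ' : W'.IsTorsionGaloisRep p ρ') :
    ModPGaloisRep.IsTresRamifie (FramedGaloisRep.restrictField (v.adicCompletion ℚ) ρ' :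
        ModPGaloisRep (v.adicCompletion ℚ) (ZMod p) 2) ↔
      ModPGaloisRep.IsTresRamifie (FramedGaloisRep.restrictField (v.adicCompletion ℚ) ρ :
        ModPGaloisRep (v.adicCompletion ℚ) (ZMod p) 2) := by
  obtain ⟨e, he⟩ := hc
  exact (isTresRamifie_restrictField_iff_of_addEquiv_decomp hρ' hρ v e he).symm

variable [W.IsElliptic] [W'.IsElliptic]

/-- **No congruent curve with good reduction for a très ramifié type.** If `W′[p] ≅ W[p]` as
`D_v`-modules (`ModPCongruentAt W′ W p v`, `v ∋ p`, `p` odd) and `ρ̄_{W,p}|Γ_{ℚ_v}` is très ramifié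
(for a framing `ρ̄`), then `W′` does NOT have good reduction at `p` — Serre 1987 §2.9 Prop. 5 (i) /
§2.8 Prop. 3 (good ⇒ peu ramifié) through
`Literature.NumberTheory.EllipticCurves.not_good_of_isTresRamifie_of_addEquiv_decomp`.
[cite: Serre1987, §2.9 Prop. 5 (i), §2.8 Prop. 3] -/
theorem ModPCongruentAt.not_good_of_isTresRamifie (hc : ModPCongruentAt W' W p v)
    (hpv : ((p : ℕ) : 𝓞 ℚ) ∈ v.asIdeal) (hp2 : p ≠ 2) {ρ : ModPGaloisRep ℚ (ZMod p) 2}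
    (hρ : W.IsTorsionGaloisRep p ρ)
    (htres : ModPGaloisRep.IsTresRamifie (FramedGaloisRep.restrictField (v.adicCompletion ℚ) ρ :
        ModPGaloisRep (v.adicCompletion ℚ) (ZMod p) 2)) :
    ¬ Good W' p := by
  obtain ⟨e, he⟩ := hc
  exact not_good_of_isTresRamifie_of_addEquiv_decomp W W' p hp2 v hpv hρ htres e he

/-- **A semistable congruent curve of a très ramifié class is MULTIPLICATIVE at `p`** (`¬ Addv` is
`Good ∨ Mult`, and `Good` is excluded). [cite: Serre1987, §2.9 Prop. 5] -/
theorem ModPCongruentAt.mult_of_isTresRamifie_of_not_addv (hc : ModPCongruentAt W' W p v)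
    (hpv : ((p : ℕ) : 𝓞 ℚ) ∈ v.asIdeal) (hp2 : p ≠ 2) {ρ : ModPGaloisRep ℚ (ZMod p) 2}
    (hρ : W.IsTorsionGaloisRep p ρ)
    (htres : ModPGaloisRep.IsTresRamifie (FramedGaloisRep.restrictField (v.adicCompletion ℚ) ρ :
        ModPGaloisRep (v.adicCompletion ℚ) (ZMod p) 2))
    (hss : ¬ Addv W' p) : Mult W' p := by
  by_contra hmult
  exact hss ⟨hc.not_good_of_isTresRamifie hpv hp2 hρ htres, hmult⟩

/-- **Global twins of a très ramifié class are not good at `p`**: `O6.ModPCongruent W′ W p`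
(`Γ_ℚ`-equivariant `W′[p] ≅ W[p]`) and `ρ̄_{W,p}` très ramifié at the place above `p` ⇒ `¬ Good W′ p`.
[cite: Serre1987, §2.9 Prop. 5 (i), §2.8 Prop. 3] -/
theorem ModPCongruent.not_good_of_isTresRamifie (hc : ModPCongruent W' W p) (hp2 : p ≠ 2)
    {ρ : ModPGaloisRep ℚ (ZMod p) 2} (hρ : W.IsTorsionGaloisRep p ρ)
    (htres : ∀ v : HeightOneSpectrum (𝓞 ℚ), ((p : ℕ) : 𝓞 ℚ) ∈ v.asIdeal →
      ModPGaloisRep.IsTresRamifie (FramedGaloisRep.restrictField (v.adicCompletion ℚ) ρ :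
        ModPGaloisRep (v.adicCompletion ℚ) (ZMod p) 2)) :
    ¬ Good W' p := by
  -- the place `v` of `ℚ` above `p` (the tree's `MixedCongruentPartnerEPW.exists_place`, inlined to
  -- keep this file's import cone inside `WAll`)
  obtain ⟨v, hpv⟩ : ∃ v : HeightOneSpectrum (𝓞 ℚ), ((p : ℕ) : 𝓞 ℚ) ∈ v.asIdeal :=
    ⟨(primesEquiv (R := 𝓞 ℚ)).symm ⟨p, Fact.out⟩,
      (Literature.NumberTheory.Automorphic.BCDT.natCast_mem_asIdeal_iff_primesEquiv_eq _ Fact.out).mpr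
        (by rw [Equiv.apply_symm_apply])⟩
  exact (hc.modPCongruentAt v).not_good_of_isTresRamifie hpv hp2 hρ (htres v hpv)

/-- **Global semistable twins of a très ramifié class are multiplicative at `p`.**
[cite: Serre1987, §2.9 Prop. 5] -/
theorem ModPCongruent.mult_of_isTresRamifie_of_not_addv (hc : ModPCongruent W' W p) (hp2 : p ≠ 2)
    {ρ : ModPGaloisRep ℚ (ZMod p) 2} (hρ : W.IsTorsionGaloisRep p ρ)
    (htres : ∀ v : HeightOneSpectrum (𝓞 ℚ), ((p : ℕ) : 𝓞 ℚ) ∈ v.asIdeal →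
      ModPGaloisRep.IsTresRamifie (FramedGaloisRep.restrictField (v.adicCompletion ℚ) ρ :
        ModPGaloisRep (v.adicCompletion ℚ) (ZMod p) 2))
    (hss : ¬ Addv W' p) : Mult W' p := by
  by_contra hmult
  exact hss ⟨hc.not_good_of_isTresRamifie hp2 hρ htres, hmult⟩

omit [W'.IsElliptic] in
/-- **For a très ramifié class the semistable mod-`p` type is a MULTIPLICATIVE type**: every witness
`W″` of `HasSemistableModPTypeAt W p` (globally minimal, `¬ Addv W″ p`, congruent to `W` at `v`) is
multiplicative at `p`; in particular a multiplicative witness exists at each `v ∋ p`.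
[cite: Serre1987, §2.9 Prop. 5] -/
theorem HasSemistableModPTypeAt.exists_mult_witness_of_isTresRamifie (h : HasSemistableModPTypeAt W p)
    (hp2 : p ≠ 2) {ρ : ModPGaloisRep ℚ (ZMod p) 2} (hρ : W.IsTorsionGaloisRep p ρ)
    (htres : ∀ v : HeightOneSpectrum (𝓞 ℚ), ((p : ℕ) : 𝓞 ℚ) ∈ v.asIdeal →
      ModPGaloisRep.IsTresRamifie (FramedGaloisRep.restrictField (v.adicCompletion ℚ) ρ :
        ModPGaloisRep (v.adicCompletion ℚ) (ZMod p) 2))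
    (v : HeightOneSpectrum (𝓞 ℚ)) (hpv : ((p : ℕ) : 𝓞 ℚ) ∈ v.asIdeal) :
    ∃ (W'' : WeierstrassCurve ℚ) (_ : W''.IsElliptic) (_ : W''.IsGloballyMinimal),
      Mult W'' p ∧ ModPCongruentAt W'' W p v := by
  obtain ⟨W'', h1, h2, hss, hc⟩ := h v hpv
  exact ⟨W'', h1, h2, hc.mult_of_isTresRamifie_of_not_addv hpv hp2 hρ (htres v hpv) hss, hc⟩

end Summit.BirchSwinnertonDyer.Rank1Residual.O6

/-! ### §2. Leaf level at `p = 3`: the twin cell's twins of a très ramifié class are multiplicative -/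

namespace Summit.BirchSwinnertonDyer

/-- **On the twin-cell hypothesis of `WAllExclAddWildRankOneSurjTwin` (VERBATIM): every semistable
onto twin `W′` of a class whose `ρ̄_{E,3}|Γ_{ℚ₃}` is très ramifié is MULTIPLICATIVE at `3`** (`3 ∥ N′`);
so for such a class route `UniversalToricDescent`'s crux #3 (`TwinSplitIMCAtThree`, over semistable
twins) is consumed only in its multiplicative instance. [cite: Serre1987, §2.9 Prop. 5] -/
theorem twin_mult_three_of_isTresRamifie {W : WeierstrassCurve ℚ} [W.IsElliptic]
    {ρ : ModPGaloisRep ℚ (ZMod 3) 2} (hρ : W.IsTorsionGaloisRep 3 ρ)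
    (htres : ∀ v : HeightOneSpectrum (𝓞 ℚ), ((3 : ℕ) : 𝓞 ℚ) ∈ v.asIdeal →
      ModPGaloisRep.IsTresRamifie (FramedGaloisRep.restrictField (v.adicCompletion ℚ) ρ :
        ModPGaloisRep (v.adicCompletion ℚ) (ZMod 3) 2))
    (W' : WeierstrassCurve ℚ) [W'.IsElliptic] [W'.IsGloballyMinimal]
    (hc : O6.ModPCongruent W' W 3) (hss : ¬ Addv W' 3) : Mult W' 3 :=
  hc.mult_of_isTresRamifie_of_not_addv (by decide) hρ htres hss

/-- **A très ramifié class with a twin has a MULTIPLICATIVE onto twin** (the twin-cell existential of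
`WAllExclAddWildRankOneSurjTwin`, sharpened: the same witness, now known to be multiplicative at `3`).
[cite: Serre1987, §2.9 Prop. 5] -/
theorem exists_multTwin_three_of_twin_of_isTresRamifie {W : WeierstrassCurve ℚ} [W.IsElliptic]
    {ρ : ModPGaloisRep ℚ (ZMod 3) 2} (hρ : W.IsTorsionGaloisRep 3 ρ)
    (htres : ∀ v : HeightOneSpectrum (𝓞 ℚ), ((3 : ℕ) : 𝓞 ℚ) ∈ v.asIdeal →
      ModPGaloisRep.IsTresRamifie (FramedGaloisRep.restrictField (v.adicCompletion ℚ) ρ :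
        ModPGaloisRep (v.adicCompletion ℚ) (ZMod 3) 2))
    (htwin : ∃ (W' : WeierstrassCurve ℚ) (_ : W'.IsElliptic) (_ : W'.IsGloballyMinimal),
      O6.ModPCongruent W' W 3 ∧ ¬ Addv W' 3 ∧ W'.HasSurjectiveModNGaloisRep 3) :
    ∃ (W' : WeierstrassCurve ℚ) (_ : W'.IsElliptic) (_ : W'.IsGloballyMinimal),
      O6.ModPCongruent W' W 3 ∧ Mult W' 3 ∧ W'.HasSurjectiveModNGaloisRep 3 := by
  obtain ⟨W', h1, h2, hc, hss, hsurj⟩ := htwin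
  exact ⟨W', h1, h2, hc, twin_mult_three_of_isTresRamifie hρ htres W' hc hss, hsurj⟩

/-- **No good twin at `3` for a très ramifié class** (the census's bucket-B rigour note as a kernel
fact at every conductor): the twin-cell existential cannot be witnessed by a curve with good reduction
at `3`. [cite: Serre1987, §2.9 Prop. 5 (i), §2.8 Prop. 3] -/
theorem not_good_three_of_twin_of_isTresRamifie {W : WeierstrassCurve ℚ} [W.IsElliptic]
    {ρ : ModPGaloisRep ℚ (ZMod 3) 2} (hρ : W.IsTorsionGaloisRep 3 ρ)
    (htres : ∀ v : HeightOneSpectrum (𝓞 ℚ), ((3 : ℕ) : 𝓞 ℚ) ∈ v.asIdeal →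
      ModPGaloisRep.IsTresRamifie (FramedGaloisRep.restrictField (v.adicCompletion ℚ) ρ :
        ModPGaloisRep (v.adicCompletion ℚ) (ZMod 3) 2))
    (W' : WeierstrassCurve ℚ) [W'.IsElliptic] (hc : O6.ModPCongruent W' W 3) : ¬ Good W' 3 :=
  hc.not_good_of_isTresRamifie (by decide) hρ htres

end Summit.BirchSwinnertonDyer
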